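import Literature.Analysis.FluidPDE.NSUniqueness2DTruncatedBalance
import Literature.Analysis.FluidPDE.NSUniqueness2DL4
import Literature.Analysis.FluidPDE.NSUniqueness2DParts
import Literature.Analysis.FunctionSpaces.TorusAnisotropicLadyzhenskaya
import Literature.Analysis.FunctionSpaces.TorusAxisAverage
import HarnessLib

/-!
# Spectral and convective estimates for the two-and-a-half-dimensional uniqueness theorem

Analysis/FluidPDE support file (theorem-only) for the discharge of the weak–strong uniqueness
theorem of Bardos–Lopes Filho–Niu–Nussenzveig Lopes–Titi, SIAM J. Math. Anal. 45 (2013),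
Thm. 3.1, on the flat torus `T³` (`FluidPDE/NSUniqueness2HalfD`, in preparation; it discharges
`Literature.Barriers.AnomalousDissipation.BardosTitiWiedemann2012_thm5_uniqueness`). The proof
runs Serrin's cross-testing at the level of Fourier truncations
(`Torus.IsLerayHopfOn.integral_inner_fourierTruncate_eq_add_setIntegral`,
`FluidPDE/LerayHopfCrossIdentityTorus`) and then lets the truncation level `N → ∞`; this file
supplies the `N`-uniform estimates and limits that are not specific to the time dependence:

* **Truncation bookkeeping** (general `d`): linearity `P_N (v - w) = P_N v - P_N w`, the nested
  difference `P_M v - P_N v` (`N ≤ M`) as one trigonometric polynomial with its `L²` mass bounded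
  by the truncation tail and its enstrophy by the enstrophy
  (`Torus.lintegral_enorm_sq_fourierTruncate_sub_fourierTruncate_le`,
  `Torus.eGradNormSq_fourierTruncate_sub_fourierTruncate_le`), and **invariance**: truncations of
  fields independent of one coordinate are independent of it (`Torus.fourierTruncate_add_single`).
* **The cross convective identity** for smooth divergence-free fields (general `d`),
  `∫⟪a,(a·∇)c⟫ + ∫⟪c,(c·∇)a⟫ = ∫⟪a - c,((a - c)·∇)c⟫`
  (`Torus.integral_inner_convect_add_integral_inner_convect_eq`; the algebra of Serrin 1963, §4,
  turning the cross terms into `b(w, c, w)`), and the **continuity of `v ↦ ∫⟪v,(v·∇)Ψ⟫` along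
  the truncations** `P_M v → v` in `L²` (`Torus.tendsto_integral_inner_convect_fourierTruncate`).
* **Spectral cross sums** (general `d`): `∫⟪P_N u, P_N U⟫ = ∑_{|k|≤N} Re⟪û,Û⟫ → ∫⟪u,U⟫`, the
  Stokes cross term `∫⟪u, ΔP_N U⟫ = -4π²∑_{|k|≤N}|k|² Re⟪û,Û⟫`, absolute summability, partial-sum
  convergence and the uniform bound `½(‖∇u‖₂² + ‖∇U‖₂²)` of the cross enstrophy series, and
  `‖∇(u - U)‖₂² = ‖∇u‖₂² + ‖∇U‖₂² - 2·4π²∑'|k|² Re⟪û,Û⟫` (`Torus.toReal_eGradNormSq_sub_eq`).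
* **The anisotropic estimates on the truncations** (`T³`, from
  `FunctionSpaces/TorusAnisotropicLadyzhenskaya`): the trilinear term on the truncations is
  bounded by the Gronwall kernel of Bardos et al. (`Torus.enorm_integral_inner_convect_truncate_sub_le`),
  and removing the truncation from the transporting field costs
  `18C ‖v‖₂^{1/2}(‖v‖₂²+‖∇v‖₂²)^{1/2} ‖P_N v - v‖₂^{1/2} ‖∇Ψ‖₂` when either the test field
  (`Torus.enorm_integral_inner_convect_sub_truncate_le`) or the transporting field
  (`Torus.enorm_integral_inner_convect_sub_truncate_le'`) is independent of `x₃` — the two error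
  terms of the limit `N → ∞`, uniform in an auxiliary level `M → ∞`.
* **Time measurability** of slice Fourier coefficients, truncations, their derivatives and the
  convective pairings against truncations along jointly measurable families (Fubini).

## References

* C. Bardos, M. C. Lopes Filho, D. Niu, H. J. Nussenzveig Lopes, E. S. Titi, SIAM J. Math.
  Anal. 45 (2013) 1871–1885 = arXiv:1201.2742, Thm. 3.1 (proof). [BardosEtAl2013]
* J. Serrin, *The initial value problem for the Navier–Stokes equations*, in: Nonlinear Problems
  (Madison 1962), 1963, §4.
* J. C. Robinson, J. L. Rodrigo, W. Sadowski, *The three-dimensional Navier–Stokes equations*,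
  CUP 2016, Lemma 4.1, §4.1.
-/

open MeasureTheory Set Filter Topology UnitAddTorus Function
open scoped ENNReal NNReal InnerProductSpace

noncomputable section

namespace Literature.Analysis.FluidPDE

open FunctionSpaces

variable {d : Type*} [Fintype d] [DecidableEq d]

/-! ### Truncations: linearity, nesting, invariance -/

/-- **The truncation is linear**: `P_N (v - w) = P_N v - P_N w` for integrable `v, w`. [folklore] -/
theorem Torus.fourierTruncate_sub {v w : UnitAddTorus d → EuclideanSpace ℝ d} (hv : Integrable v volume)
    (hw : Integrable w volume) (N : ℕ) :
    Torus.fourierTruncate N (v - w) = Torus.fourierTruncate N v - Torus.fourierTruncate N w := by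
  rw [Torus.fourierTruncate_eq, Torus.fourierTruncate_eq, Torus.fourierTruncate_eq, ← Torus.realTrigPoly_sub]
  congr 1
  funext k
  rw [Torus.complexify_comp_sub, Torus.mFourierCoeff_sub (Torus.integrable_complexify_comp hv)
    (Torus.integrable_complexify_comp hw)]
  rfl

/-- Slices: `P_N (v - w) x = P_N v x - P_N w x`. [folklore] -/
theorem Torus.fourierTruncate_sub_apply {v w : UnitAddTorus d → EuclideanSpace ℝ d} (hv : Integrable v volume)
    (hw : Integrable w volume) (N : ℕ) (x : UnitAddTorus d) :
    Torus.fourierTruncate N (fun y => v y - w y) x = Torus.fourierTruncate N v x - Torus.fourierTruncate N w x := by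
  have h := congrFun (Torus.fourierTruncate_sub hv hw N) x
  exact h

/-- **Nested truncations** as one trigonometric polynomial: for `N ≤ M`,
`P_M v - P_N v = Re ∑_{|k|≤M} e_k • 𝟙[|k|>N] v̂(k)`. [folklore] -/
theorem Torus.fourierTruncate_sub_fourierTruncate_eq {v : UnitAddTorus d → EuclideanSpace ℝ d} {N M : ℕ}
    (hNM : N ≤ M) :
    Torus.fourierTruncate M v - Torus.fourierTruncate N v =
      Torus.realTrigPoly (Torus.freqBall M) (fun k => if k ∈ Torus.freqBall N then 0 else
        mFourierCoeff (EuclideanSpace.complexify ∘ v) k) := by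
  have hN : Torus.fourierTruncate N v = Torus.realTrigPoly (Torus.freqBall M)
      (fun k => if k ∈ Torus.freqBall N then mFourierCoeff (EuclideanSpace.complexify ∘ v) k else 0) := by
    rw [Torus.fourierTruncate_eq, Torus.realTrigPoly_eq_comp, Torus.realTrigPoly_eq_comp,
      Torus.trigPoly_subset (Torus.freqBall_mono hNM) (fun k _ hk => if_neg hk)]
    congr 1
    exact Torus.trigPoly_congr fun k hk => (if_pos hk).symm
  rw [hN, Torus.fourierTruncate_eq, ← Torus.realTrigPoly_sub]
  congr 1
  funext k
  by_cases hk : k ∈ Torus.freqBall N <;> simp [hk]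

/-- The coefficient family of the nested difference is conjugate symmetric. [folklore] -/
theorem Torus.isConjSymm_ite_mFourierCoeff {v : UnitAddTorus d → EuclideanSpace ℝ d}
    (hv : Integrable v volume) (N : ℕ) :
    Torus.IsConjSymm (fun k => if k ∈ Torus.freqBall N then (0 : EuclideanSpace ℂ d) else
      mFourierCoeff (EuclideanSpace.complexify ∘ v) k) := by
  intro k
  have hc := Torus.isConjSymm_mFourierCoeff hv k
  by_cases hk : k ∈ Torus.freqBall N
  · have hk' : -k ∈ Torus.freqBall N := Torus.neg_mem_freqBall.2 hk
    simp [hk, hk']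
  · have hk' : -k ∉ Torus.freqBall N := fun h => hk (Torus.neg_mem_freqBall.1 h)
    simp only [hk, hk', ite_false]
    exact hc

/-- **`L²` mass of the nested difference** is at most the truncation tail:
`∫⁻ ‖P_M v - P_N v‖ₑ² ≤ ∫⁻ ‖P_N v - v‖ₑ²` for `N ≤ M`, `v ∈ L²`. [folklore] -/
theorem Torus.lintegral_enorm_sq_fourierTruncate_sub_fourierTruncate_le
    {v : UnitAddTorus d → EuclideanSpace ℝ d} (hv : MemLp v 2 volume) {N M : ℕ} (hNM : N ≤ M) :
    ∫⁻ x, ‖Torus.fourierTruncate M v x - Torus.fourierTruncate N v x‖ₑ ^ 2 ≤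
      ∫⁻ x, ‖Torus.fourierTruncate N v x - v x‖ₑ ^ 2 := by
  have hvi : Integrable v volume := hv.integrable one_le_two
  set c : (d → ℤ) → EuclideanSpace ℂ d := fun k => if k ∈ Torus.freqBall N then 0 else
    mFourierCoeff (EuclideanSpace.complexify ∘ v) k with hc
  have hcs : Torus.IsConjSymm c := Torus.isConjSymm_ite_mFourierCoeff hvi N
  have heq : ∀ x, Torus.fourierTruncate M v x - Torus.fourierTruncate N v x = Torus.realTrigPoly (Torus.freqBall M) c x :=
    fun x => congrFun (Torus.fourierTruncate_sub_fourierTruncate_eq (v := v) hNM) x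
  simp_rw [heq]
  rw [← Torus.tsum_enorm_sq_mFourierCoeff_complexify (Torus.memLp_realTrigPoly _ _ 2),
    Torus.lintegral_enorm_sq_fourierTruncate_sub hv]
  set g : (d → ℤ) → ℝ≥0∞ := fun k =>
    ‖mFourierCoeff (EuclideanSpace.complexify ∘ Torus.realTrigPoly (Torus.freqBall M) c) k‖ₑ ^ 2 with hg
  have hg_le : ∀ k, g k ≤ ({k : d → ℤ | k ∉ Torus.freqBall N} : Set (d → ℤ)).indicator
      (fun k => ‖mFourierCoeff (EuclideanSpace.complexify ∘ v) k‖ₑ ^ 2) k := by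
    intro k
    simp only [hg, Set.indicator_apply, Set.mem_setOf_eq]
    rw [Torus.mFourierCoeff_realTrigPoly Torus.neg_mem_freqBall_of_mem hcs]
    simp only [hc]
    by_cases hkM : k ∈ Torus.freqBall M
    · by_cases hkN : k ∈ Torus.freqBall N
      · simp [hkM, hkN]
      · simp [hkM, hkN]
    · simp [hkM]
  calc ∑' k, g k ≤ ∑' k, ({k : d → ℤ | k ∉ Torus.freqBall N} : Set (d → ℤ)).indicator
        (fun k => ‖mFourierCoeff (EuclideanSpace.complexify ∘ v) k‖ₑ ^ 2) k := ENNReal.tsum_le_tsum hg_le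
    _ = ∑' k : ({k : d → ℤ | k ∉ Torus.freqBall N} : Set (d → ℤ)),
        ‖mFourierCoeff (EuclideanSpace.complexify ∘ v) k‖ₑ ^ 2 := (tsum_subtype _ _).symm
    _ = _ := rfl

/-- **Enstrophy of the nested difference** is at most the enstrophy:
`eGradNormSq (P_M v - P_N v) ≤ eGradNormSq v` for `N ≤ M`. [folklore] -/
theorem Torus.eGradNormSq_fourierTruncate_sub_fourierTruncate_le
    {v : UnitAddTorus d → EuclideanSpace ℝ d} (hv : Integrable v volume) {N M : ℕ} (hNM : N ≤ M) :
    Torus.eGradNormSq (Torus.fourierTruncate M v - Torus.fourierTruncate N v) ≤ Torus.eGradNormSq v := by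
  set c : (d → ℤ) → EuclideanSpace ℂ d := fun k => if k ∈ Torus.freqBall N then 0 else
    mFourierCoeff (EuclideanSpace.complexify ∘ v) k with hc
  have hcs : Torus.IsConjSymm c := Torus.isConjSymm_ite_mFourierCoeff hv N
  rw [Torus.fourierTruncate_sub_fourierTruncate_eq hNM, Torus.eGradNormSq_eq_tsum, Torus.eGradNormSq_eq_tsum]
  refine mul_le_mul_right (ENNReal.tsum_le_tsum fun k => ?_) _
  rw [Torus.mFourierCoeff_realTrigPoly Torus.neg_mem_freqBall_of_mem hcs]
  simp only [hc]
  by_cases hkM : k ∈ Torus.freqBall M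
  · by_cases hkN : k ∈ Torus.freqBall N
    · simp [hkM, hkN]
    · simp [hkM, hkN]
  · simp [hkM]

/-- **Truncations of vertically invariant fields are vertically invariant** (an invariant
integrable field has no Fourier modes with `kᵢ ≠ 0`, `Torus.mFourierCoeff_eq_zero_of_forall_add_single`,
and a trigonometric polynomial without such modes is invariant, `Torus.realTrigPoly_add_single`). [folklore] -/
theorem Torus.fourierTruncate_add_single {v : UnitAddTorus d → EuclideanSpace ℝ d} {i : d}
    (hinv : ∀ (s : UnitAddCircle) (x : UnitAddTorus d), v (x + Pi.single i s) = v x) (N : ℕ)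
    (s : UnitAddCircle) (x : UnitAddTorus d) :
    Torus.fourierTruncate N v (x + Pi.single i s) = Torus.fourierTruncate N v x := by
  rw [Torus.fourierTruncate_eq]
  refine Torus.realTrigPoly_add_single (fun k _ hk => ?_) s x
  exact Torus.mFourierCoeff_eq_zero_of_forall_add_single (f := EuclideanSpace.complexify ∘ v)
    (fun s' y => by simp [hinv s' y]) hk

/-! ### The convective pairing `∫ ⟪v, (v·∇)Ψ⟫`: algebra and continuity -/

/-- **The cross convective identity for smooth divergence-free fields**:
`∫ ⟪a, (a·∇)c⟫ + ∫ ⟪c, (c·∇)a⟫ = ∫ ⟪a - c, ((a - c)·∇)c⟫`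
(expand the right-hand side; `∫ ⟪c, (c·∇)c⟫ = 0`, `∫ ⟪c, (a·∇)c⟫ = ½∫ (a·∇)‖c‖² = 0` for
divergence-free `a`, and `∫ ⟪a, (c·∇)c⟫ + ∫ ⟪c, (c·∇)a⟫ = ∫ (c·∇)⟪a, c⟫ = 0` for divergence-free
`c`; Evans, App. C.2; the torus transport identity `Torus.integral_fderiv_apply_eq_zero_of_isDivFree`).
This is the algebra turning Serrin's cross terms into the trilinear term `b(w, c, w)`,
`w = a - c` (Serrin 1963, §4; Bardos et al. 2013, proof of Thm. 3.1, passage to (2.8)). [folklore] -/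
theorem Torus.integral_inner_convect_add_integral_inner_convect_eq
    {a c : UnitAddTorus d → EuclideanSpace ℝ d} (ha : Torus.IsSmooth a) (hc : Torus.IsSmooth c)
    (hdiva : Torus.IsDivFree a) (hdivc : Torus.IsDivFree c) :
    (∫ x, ⟪a x, Torus.convect a c x⟫_ℝ) + ∫ x, ⟪c x, Torus.convect c a x⟫_ℝ =
      ∫ x, ⟪a x - c x, Torus.convect (fun y => a y - c y) c x⟫_ℝ := by
  have ha1 : Torus.IsContDiff 1 a := ha.isContDiff (by simp)
  have hc1 : Torus.IsContDiff 1 c := hc.isContDiff (by simp)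
  -- continuity of the building blocks
  have hcont : ∀ {p q r : UnitAddTorus d → EuclideanSpace ℝ d}, Continuous p → Continuous q →
      Torus.IsSmooth r → Continuous fun x => ⟪p x, Torus.fderiv r x (q x)⟫_ℝ := by
    intro p q r hp hq hr
    have h : (fun x => Torus.fderiv r x (q x)) = fun x => ∑ i, (q x) i • Torus.partialDeriv i r x := by
      funext x; exact Torus.fderiv_apply_eq_sum_partialDeriv (hr.isContDiff (by simp)) _ _
    refine hp.inner ?_
    rw [h]
    exact continuous_finsetSum _ fun i _ =>
      (((EuclideanSpace.proj (𝕜 := ℝ) i).continuous.comp hq).smul (hr.partialDeriv i).continuous)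
  have hac : Continuous a := ha.continuous
  have hcc : Continuous c := hc.continuous
  -- the four pieces of the expansion
  have i1 : Integrable (fun x => ⟪a x, Torus.fderiv c x (a x)⟫_ℝ) volume := (hcont hac hac hc).integrable_unitAddTorus
  have i2 : Integrable (fun x => ⟪a x, Torus.fderiv c x (c x)⟫_ℝ) volume := (hcont hac hcc hc).integrable_unitAddTorus
  have i3 : Integrable (fun x => ⟪c x, Torus.fderiv c x (a x)⟫_ℝ) volume := (hcont hcc hac hc).integrable_unitAddTorus
  have i4 : Integrable (fun x => ⟪c x, Torus.fderiv c x (c x)⟫_ℝ) volume := (hcont hcc hcc hc).integrable_unitAddTorus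
  have i5 : Integrable (fun x => ⟪c x, Torus.fderiv a x (c x)⟫_ℝ) volume := (hcont hcc hcc ha).integrable_unitAddTorus
  -- (1) `∫ ⟪c, (c·∇)c⟫ = 0`
  have z4 : ∫ x, ⟪c x, Torus.fderiv c x (c x)⟫_ℝ = 0 := by
    have h := Torus.integral_inner_convect_self_eq_zero hc hdivc
    simp_rw [Torus.convect, real_inner_comm] at h
    exact h
  -- (2) `∫ ⟪c, (a·∇)c⟫ = ½ ∫ (a·∇)‖c‖² = 0`
  have z3 : ∫ x, ⟪c x, Torus.fderiv c x (a x)⟫_ℝ = 0 := by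
    have h := Torus.integral_fderiv_apply_eq_zero_of_isDivFree ha hc.norm_sq hdiva
    simp_rw [Torus.fderiv_norm_sq_apply hc1] at h
    rw [integral_const_mul] at h
    simpa using h
  -- (3) `∫ ⟪a, (c·∇)c⟫ + ∫ ⟪c, (c·∇)a⟫ = ∫ (c·∇)⟪a,c⟫ = 0`
  have z25 : (∫ x, ⟪a x, Torus.fderiv c x (c x)⟫_ℝ) + ∫ x, ⟪c x, Torus.fderiv a x (c x)⟫_ℝ = 0 := by
    have h := Torus.integral_fderiv_apply_eq_zero_of_isDivFree hc (ha.inner hc) hdivc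
    simp_rw [Torus.fderiv_inner_apply ha1 hc1] at h
    rw [integral_add i2 (i5.congr (ae_of_all _ fun x => real_inner_comm _ _))] at h
    have h5 : ∫ x, ⟪Torus.fderiv a x (c x), c x⟫_ℝ = ∫ x, ⟪c x, Torus.fderiv a x (c x)⟫_ℝ :=
      integral_congr_ae (ae_of_all _ fun x => real_inner_comm _ _)
    rw [h5] at h
    exact h
  -- expand the right-hand side
  have hexp : ∀ x, ⟪a x - c x, Torus.convect (fun y => a y - c y) c x⟫_ℝ =
      ⟪a x, Torus.fderiv c x (a x)⟫_ℝ - ⟪a x, Torus.fderiv c x (c x)⟫_ℝ -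
        (⟪c x, Torus.fderiv c x (a x)⟫_ℝ - ⟪c x, Torus.fderiv c x (c x)⟫_ℝ) := by
    intro x
    rw [Torus.convect, map_sub, inner_sub_left, inner_sub_right, inner_sub_right]
  simp_rw [hexp]
  have i12 : Integrable (fun x => ⟪a x, Torus.fderiv c x (a x)⟫_ℝ - ⟪a x, Torus.fderiv c x (c x)⟫_ℝ) volume :=
    i1.sub i2
  have i34 : Integrable (fun x => ⟪c x, Torus.fderiv c x (a x)⟫_ℝ - ⟪c x, Torus.fderiv c x (c x)⟫_ℝ) volume :=
    i3.sub i4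
  rw [integral_sub i12 i34, integral_sub i1 i2, integral_sub i3 i4, z4, z3]
  simp only [Torus.convect]
  linarith

/-- **Lipschitz-type bound of the convective pairing in the transported field**: for `v, w ∈ L²`
and a `C¹` test field `Ψ` with `‖DΨ(x) h‖ ≤ ‖h‖ K`,
`‖∫ ⟪v, (v·∇)Ψ⟫ - ∫ ⟪w, (w·∇)Ψ⟫‖ ≤ K ‖v - w‖₂ (‖v‖₂ + ‖w‖₂)`
(`⟪v,DΨ[v]⟫ - ⟪w,DΨ[w]⟫ = ⟪v - w, DΨ[v]⟫ + ⟪w, DΨ[v - w]⟫` and Cauchy–Schwarz), in `ℝ≥0∞`. [folklore] -/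
theorem Torus.enorm_integral_inner_convect_sub_le {v w Ψ : UnitAddTorus d → EuclideanSpace ℝ d}
    (hv : MemLp v 2 volume) (hw : MemLp w 2 volume) (hΨ : Torus.IsSmooth Ψ) {K : ℝ} (hK0 : 0 ≤ K)
    (hK : ∀ x h, ‖Torus.fderiv Ψ x h‖ ≤ ‖h‖ * K) :
    ‖(∫ x, ⟪v x, Torus.convect v Ψ x⟫_ℝ) - ∫ x, ⟪w x, Torus.convect w Ψ x⟫_ℝ‖ₑ ≤
      ENNReal.ofReal K * (∫⁻ x, ‖v x - w x‖ₑ ^ 2) ^ (1 / 2 : ℝ) *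
        ((∫⁻ x, ‖v x‖ₑ ^ 2) ^ (1 / 2 : ℝ) + (∫⁻ x, ‖w x‖ₑ ^ 2) ^ (1 / 2 : ℝ)) := by
  have iv := integrable_inner_convect_self hv hΨ
  have iw := integrable_inner_convect_self hw hΨ
  rw [← integral_sub iv iw]
  refine (enorm_integral_le_lintegral_enorm _).trans ?_
  -- pointwise bound
  have hpt : ∀ x, ‖⟪v x, Torus.convect v Ψ x⟫_ℝ - ⟪w x, Torus.convect w Ψ x⟫_ℝ‖ₑ ≤
      ENNReal.ofReal K * (‖v x - w x‖ₑ * ‖v x‖ₑ + ‖v x - w x‖ₑ * ‖w x‖ₑ) := by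
    intro x
    have h1 : ⟪v x, Torus.convect v Ψ x⟫_ℝ - ⟪w x, Torus.convect w Ψ x⟫_ℝ =
        ⟪v x - w x, Torus.fderiv Ψ x (v x)⟫_ℝ + ⟪w x, Torus.fderiv Ψ x (v x - w x)⟫_ℝ := by
      simp only [Torus.convect, map_sub, inner_sub_left, inner_sub_right]
      ring
    rw [h1]
    have hr : ‖⟪v x - w x, Torus.fderiv Ψ x (v x)⟫_ℝ + ⟪w x, Torus.fderiv Ψ x (v x - w x)⟫_ℝ‖ ≤
        K * (‖v x - w x‖ * ‖v x‖ + ‖v x - w x‖ * ‖w x‖) := by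
      refine (norm_add_le _ _).trans ?_
      have e1 : ‖⟪v x - w x, Torus.fderiv Ψ x (v x)⟫_ℝ‖ ≤ ‖v x - w x‖ * (‖v x‖ * K) :=
        (norm_inner_le_norm _ _).trans (mul_le_mul_of_nonneg_left (hK x _) (norm_nonneg _))
      have e2 : ‖⟪w x, Torus.fderiv Ψ x (v x - w x)⟫_ℝ‖ ≤ ‖w x‖ * (‖v x - w x‖ * K) :=
        (norm_inner_le_norm _ _).trans (mul_le_mul_of_nonneg_left (hK x _) (norm_nonneg _))
      nlinarith
    rw [← ofReal_norm, ← ofReal_norm, ← ofReal_norm, ← ofReal_norm (w x), ← ENNReal.ofReal_mul (norm_nonneg _),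
      ← ENNReal.ofReal_mul (norm_nonneg _), ← ENNReal.ofReal_add (by positivity) (by positivity),
      ← ENNReal.ofReal_mul hK0]
    exact ENNReal.ofReal_le_ofReal hr
  refine (lintegral_mono hpt).trans ?_
  have mv : AEMeasurable (fun x => ‖v x‖ₑ) volume := hv.aestronglyMeasurable.aemeasurable.enorm
  have mw : AEMeasurable (fun x => ‖w x‖ₑ) volume := hw.aestronglyMeasurable.aemeasurable.enorm
  have mvw : AEMeasurable (fun x => ‖v x - w x‖ₑ) volume :=
    (hv.aestronglyMeasurable.sub hw.aestronglyMeasurable).aemeasurable.enorm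
  have hsplit : ∫⁻ x, (‖v x - w x‖ₑ * ‖v x‖ₑ + ‖v x - w x‖ₑ * ‖w x‖ₑ) =
      (∫⁻ x, ‖v x - w x‖ₑ * ‖v x‖ₑ) + ∫⁻ x, ‖v x - w x‖ₑ * ‖w x‖ₑ :=
    lintegral_add_left' (mvw.mul mv) _
  rw [lintegral_const_mul' _ _ ENNReal.ofReal_ne_top, hsplit]
  have e1 := FunctionSpaces.Torus.lintegral_mul_le_sqrt_mul_sqrt mvw mv
  have e2 := FunctionSpaces.Torus.lintegral_mul_le_sqrt_mul_sqrt mvw mw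
  calc ENNReal.ofReal K * ((∫⁻ x, ‖v x - w x‖ₑ * ‖v x‖ₑ) + ∫⁻ x, ‖v x - w x‖ₑ * ‖w x‖ₑ)
      ≤ ENNReal.ofReal K * ((∫⁻ x, ‖v x - w x‖ₑ ^ 2) ^ (1 / 2 : ℝ) * (∫⁻ x, ‖v x‖ₑ ^ 2) ^ (1 / 2 : ℝ) +
          (∫⁻ x, ‖v x - w x‖ₑ ^ 2) ^ (1 / 2 : ℝ) * (∫⁻ x, ‖w x‖ₑ ^ 2) ^ (1 / 2 : ℝ)) := by
        gcongr
    _ = _ := by ring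

/-- **Continuity of the convective pairing along the truncations**:
`∫ ⟪P_M v, (P_M v·∇)Ψ⟫ → ∫ ⟪v, (v·∇)Ψ⟫` as `M → ∞`, for `v ∈ L²` and smooth `Ψ`
(`Torus.enorm_integral_inner_convect_sub_le`, Bessel, and `P_M v → v` in `L²`). [folklore] -/
theorem Torus.tendsto_integral_inner_convect_fourierTruncate {v Ψ : UnitAddTorus d → EuclideanSpace ℝ d}
    (hv : MemLp v 2 volume) (hΨ : Torus.IsSmooth Ψ) :
    Tendsto (fun M => ∫ x, ⟪Torus.fourierTruncate M v x, Torus.convect (Torus.fourierTruncate M v) Ψ x⟫_ℝ)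
      atTop (𝓝 (∫ x, ⟪v x, Torus.convect v Ψ x⟫_ℝ)) := by
  obtain ⟨D, hD0, hD⟩ := Torus.exists_sum_norm_partialDeriv_le hΨ
  have hK : ∀ x h, ‖Torus.fderiv Ψ x h‖ ≤ ‖h‖ * D := fun x h =>
    (Torus.norm_fderiv_apply_le (hΨ.isContDiff (by simp)) x h).trans
      (mul_le_mul_of_nonneg_left (hD x) (norm_nonneg _))
  set A : ℝ≥0∞ := ∫⁻ x, ‖v x‖ₑ ^ 2 with hA
  have hAtop : A ≠ ⊤ := by
    have h := lintegral_rpow_enorm_lt_top_of_eLpNorm_lt_top two_ne_zero ENNReal.ofNat_ne_top hv.eLpNorm_lt_top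
    simpa only [ENNReal.toReal_ofNat, ENNReal.rpow_ofNat] using h.ne
  set δ : ℕ → ℝ≥0∞ := fun M => ∫⁻ x, ‖Torus.fourierTruncate M v x - v x‖ₑ ^ 2 with hδ
  -- the bound
  have hbound : ∀ M, ‖(∫ x, ⟪Torus.fourierTruncate M v x, Torus.convect (Torus.fourierTruncate M v) Ψ x⟫_ℝ) -
      ∫ x, ⟪v x, Torus.convect v Ψ x⟫_ℝ‖ₑ ≤ ENNReal.ofReal D * δ M ^ (1 / 2 : ℝ) * (2 * A ^ (1 / 2 : ℝ)) := by
    intro M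
    have hvM := Torus.memLp_fourierTruncate M v 2
    have h := Torus.enorm_integral_inner_convect_sub_le hvM hv hΨ hD0 hK
    refine h.trans ?_
    have hB : ∫⁻ x, ‖Torus.fourierTruncate M v x‖ₑ ^ 2 ≤ A := Torus.lintegral_enorm_sq_fourierTruncate_le hv M
    calc ENNReal.ofReal D * (∫⁻ x, ‖Torus.fourierTruncate M v x - v x‖ₑ ^ 2) ^ (1 / 2 : ℝ) *
          ((∫⁻ x, ‖Torus.fourierTruncate M v x‖ₑ ^ 2) ^ (1 / 2 : ℝ) + A ^ (1 / 2 : ℝ))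
        ≤ ENNReal.ofReal D * δ M ^ (1 / 2 : ℝ) * (A ^ (1 / 2 : ℝ) + A ^ (1 / 2 : ℝ)) := by
          gcongr
      _ = _ := by rw [two_mul]
  -- the bound tends to zero
  have hδ0 : Tendsto δ atTop (𝓝 0) := Torus.tendsto_lintegral_enorm_sq_fourierTruncate_sub hv
  have hδ0' : Tendsto (fun M => δ M ^ (1 / 2 : ℝ)) atTop (𝓝 0) := by
    have hc : ContinuousAt (fun a : ℝ≥0∞ => a ^ (1 / 2 : ℝ)) 0 := ENNReal.continuous_rpow_const.continuousAt
    have := hc.tendsto.comp hδ0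
    rwa [ENNReal.zero_rpow_of_pos (by norm_num : (0 : ℝ) < 1 / 2)] at this
  have hb0 : Tendsto (fun M => ENNReal.ofReal D * δ M ^ (1 / 2 : ℝ) * (2 * A ^ (1 / 2 : ℝ))) atTop (𝓝 0) := by
    have h1 : Tendsto (fun M => ENNReal.ofReal D * δ M ^ (1 / 2 : ℝ)) atTop (𝓝 0) := by
      have := ENNReal.Tendsto.const_mul (a := ENNReal.ofReal D) hδ0' (Or.inr ENNReal.ofReal_ne_top)
      rwa [mul_zero] at this
    have h2 := ENNReal.Tendsto.mul_const (b := 2 * A ^ (1 / 2 : ℝ)) h1 (Or.inr (ENNReal.mul_ne_top ENNReal.ofNat_ne_top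
      (ENNReal.rpow_ne_top_of_nonneg (by norm_num : (0 : ℝ) ≤ 1 / 2) hAtop)))
    rwa [zero_mul] at h2
  -- squeeze
  have hen : Tendsto (fun M => ‖(∫ x, ⟪Torus.fourierTruncate M v x, Torus.convect (Torus.fourierTruncate M v) Ψ x⟫_ℝ) -
      ∫ x, ⟪v x, Torus.convect v Ψ x⟫_ℝ‖ₑ) atTop (𝓝 0) :=
    tendsto_of_tendsto_of_tendsto_of_le_of_le tendsto_const_nhds hb0 (fun _ => zero_le) hbound
  rw [tendsto_iff_edist_tendsto_0]
  simpa only [edist_eq_enorm_sub] using hen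

/-! ### Spectral cross sums of two `L²` fields -/

/-- **Truncated cross inner products**: `∫ ⟪P_N u, P_N U⟫ = ∑_{|k|≤N} Re ⟪û(k), Û(k)⟫_ℂ`. [folklore] -/
theorem Torus.integral_inner_fourierTruncate_fourierTruncate {u U : UnitAddTorus d → EuclideanSpace ℝ d}
    (hu : Integrable u volume) (hU : Integrable U volume) (N : ℕ) :
    ∫ x, ⟪Torus.fourierTruncate N u x, Torus.fourierTruncate N U x⟫_ℝ =
      ∑ k ∈ Torus.freqBall N, (inner ℂ (mFourierCoeff (EuclideanSpace.complexify ∘ u) k)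
        (mFourierCoeff (EuclideanSpace.complexify ∘ U) k)).re := by
  rw [Torus.integral_inner_fourierTruncate_left hu (Torus.memLp_fourierTruncate N U 2)]
  refine Finset.sum_congr rfl fun k hk => ?_
  rw [Torus.mFourierCoeff_fourierTruncate hU, if_pos hk]

/-- **The truncated cross inner products converge**: `∫ ⟪P_N u, P_N U⟫ → ∫ ⟪u, U⟫` for
`u, U ∈ L²` (Parseval, `Torus.hasSum_re_inner_mFourierCoeff_complexify`, along the exhausting balls). [folklore] -/
theorem Torus.tendsto_integral_inner_fourierTruncate_fourierTruncate {u U : UnitAddTorus d → EuclideanSpace ℝ d}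
    (hu : MemLp u 2 volume) (hU : MemLp U 2 volume) :
    Tendsto (fun N => ∫ x, ⟪Torus.fourierTruncate N u x, Torus.fourierTruncate N U x⟫_ℝ) atTop
      (𝓝 (∫ x, ⟪u x, U x⟫_ℝ)) := by
  have h := (Torus.hasSum_re_inner_mFourierCoeff_complexify hu hU).comp Torus.tendsto_freqBall_atTop
  refine h.congr fun N => ?_
  rw [Function.comp_apply, Torus.integral_inner_fourierTruncate_fourierTruncate (hu.integrable one_le_two)
    (hU.integrable one_le_two)]

/-- **The Stokes cross term on a truncation**: `∫ ⟪u, Δ P_N U⟫ = -4π² ∑_{|k|≤N} |k|² Re ⟪û(k), Û(k)⟫`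
for integrable `u, U` (Fourier multiplier of the Laplacian on trigonometric polynomials and the
pairing formula `Torus.integral_inner_realTrigPoly_of_integrable`). [folklore] -/
theorem Torus.integral_inner_laplacian_fourierTruncate_cross {u U : UnitAddTorus d → EuclideanSpace ℝ d}
    (hu : Integrable u volume) (N : ℕ) :
    ∫ x, ⟪u x, Torus.laplacian (Torus.fourierTruncate N U) x⟫_ℝ =
      -(4 * Real.pi ^ 2 * ∑ k ∈ Torus.freqBall N, Torus.freqNormSq k *
        (inner ℂ (mFourierCoeff (EuclideanSpace.complexify ∘ u) k)
          (mFourierCoeff (EuclideanSpace.complexify ∘ U) k)).re) := by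
  have hlap : Torus.laplacian (Torus.fourierTruncate N U) = Torus.realTrigPoly (Torus.freqBall N) (fun k =>
      -(((4 * Real.pi ^ 2 * Torus.freqNormSq k : ℝ) : ℂ) • mFourierCoeff (EuclideanSpace.complexify ∘ U) k)) :=
    funext fun x => Torus.laplacian_realTrigPoly _ _ x
  rw [hlap, Torus.integral_inner_realTrigPoly_of_integrable _ _ hu, Finset.mul_sum, ← Finset.sum_neg_distrib]
  refine Finset.sum_congr rfl fun k _ => ?_
  rw [inner_neg_right, inner_smul_right, Complex.neg_re, Complex.re_ofReal_mul]
  ring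

omit [DecidableEq d] in
/-- The `|k|²`-weighted squared coefficients of a finite-enstrophy field are summable (real form
of `eGradNormSq v < ∞`). [folklore] -/
theorem Torus.summable_freqNormSq_mul_norm_sq {v : UnitAddTorus d → EuclideanSpace ℝ d}
    (hv : Torus.eGradNormSq v ≠ ⊤) :
    Summable fun k : d → ℤ => Torus.freqNormSq k * ‖mFourierCoeff (EuclideanSpace.complexify ∘ v) k‖ ^ 2 := by
  have hfin : ∑' k : d → ℤ, ENNReal.ofReal (Torus.freqNormSq k) *
      ‖mFourierCoeff (EuclideanSpace.complexify ∘ v) k‖ₑ ^ 2 ≠ ⊤ := by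
    intro h
    rw [Torus.eGradNormSq_eq_tsum, h, ENNReal.mul_top (by positivity)] at hv
    exact hv rfl
  have h := ENNReal.summable_toReal hfin
  refine h.congr fun k => ?_
  rw [ENNReal.toReal_mul, ENNReal.toReal_ofReal (Torus.freqNormSq_nonneg k), ← ofReal_norm,
    ← ENNReal.ofReal_pow (norm_nonneg _), ENNReal.toReal_ofReal (sq_nonneg _)]

omit [DecidableEq d] in
/-- The real spectral sum of a field is its enstrophy: `4π² ∑' |k|² ‖v̂(k)‖² = (eGradNormSq v).toReal`
(both sides are the junk value `0` when the enstrophy is infinite). [folklore] -/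
theorem Torus.tsum_freqNormSq_mul_norm_sq_eq (v : UnitAddTorus d → EuclideanSpace ℝ d) :
    4 * Real.pi ^ 2 * ∑' k : d → ℤ, Torus.freqNormSq k * ‖mFourierCoeff (EuclideanSpace.complexify ∘ v) k‖ ^ 2 =
      (Torus.eGradNormSq v).toReal := by
  rw [Torus.eGradNormSq_eq_tsum, ENNReal.toReal_mul, ENNReal.toReal_ofReal (by positivity),
    ENNReal.tsum_toReal_eq fun k => ENNReal.mul_ne_top ENNReal.ofReal_ne_top (ENNReal.pow_ne_top enorm_ne_top)]
  congr 1
  refine tsum_congr fun k => ?_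
  rw [ENNReal.toReal_mul, ENNReal.toReal_ofReal (Torus.freqNormSq_nonneg k), ← ofReal_norm,
    ← ENNReal.ofReal_pow (norm_nonneg _), ENNReal.toReal_ofReal (sq_nonneg _)]

omit [Fintype d] [DecidableEq d] in
/-- Pointwise bound of the cross term: `|k|² |Re ⟪û, Û⟫| ≤ ½ |k|² (‖û‖² + ‖Û‖²)`. [folklore] -/
theorem Torus.abs_freqNormSq_mul_re_inner_le [Fintype d] (k : d → ℤ) (a b : EuclideanSpace ℂ d) :
    |Torus.freqNormSq k * (inner ℂ a b).re| ≤ 2⁻¹ * (Torus.freqNormSq k * ‖a‖ ^ 2 + Torus.freqNormSq k * ‖b‖ ^ 2) := by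
  rw [abs_mul, abs_of_nonneg (Torus.freqNormSq_nonneg k)]
  have h1 : |(inner ℂ a b).re| ≤ ‖a‖ * ‖b‖ := (Complex.abs_re_le_norm _).trans (norm_inner_le_norm a b)
  have h2 : ‖a‖ * ‖b‖ ≤ 2⁻¹ * (‖a‖ ^ 2 + ‖b‖ ^ 2) := by nlinarith [sq_nonneg (‖a‖ - ‖b‖)]
  calc Torus.freqNormSq k * |(inner ℂ a b).re| ≤ Torus.freqNormSq k * (2⁻¹ * (‖a‖ ^ 2 + ‖b‖ ^ 2)) :=
        mul_le_mul_of_nonneg_left (h1.trans h2) (Torus.freqNormSq_nonneg k)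
    _ = _ := by ring

omit [DecidableEq d] in
/-- **The cross enstrophy series is absolutely summable** for two finite-enstrophy fields. [folklore] -/
theorem Torus.summable_freqNormSq_mul_re_inner {u U : UnitAddTorus d → EuclideanSpace ℝ d}
    (hu : Torus.eGradNormSq u ≠ ⊤) (hU : Torus.eGradNormSq U ≠ ⊤) :
    Summable fun k : d → ℤ => Torus.freqNormSq k *
      (inner ℂ (mFourierCoeff (EuclideanSpace.complexify ∘ u) k) (mFourierCoeff (EuclideanSpace.complexify ∘ U) k)).re := by
  refine Summable.of_norm_bounded (((Torus.summable_freqNormSq_mul_norm_sq hu).add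
    (Torus.summable_freqNormSq_mul_norm_sq hU)).mul_left 2⁻¹) fun k => ?_
  rw [Real.norm_eq_abs]
  exact Torus.abs_freqNormSq_mul_re_inner_le k _ _

/-- **The partial cross enstrophy sums converge** to the cross enstrophy series along the balls. [folklore] -/
theorem Torus.tendsto_sum_freqNormSq_mul_re_inner {u U : UnitAddTorus d → EuclideanSpace ℝ d}
    (hu : Torus.eGradNormSq u ≠ ⊤) (hU : Torus.eGradNormSq U ≠ ⊤) :
    Tendsto (fun N => ∑ k ∈ Torus.freqBall N, Torus.freqNormSq k *
      (inner ℂ (mFourierCoeff (EuclideanSpace.complexify ∘ u) k) (mFourierCoeff (EuclideanSpace.complexify ∘ U) k)).re)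
      atTop (𝓝 (∑' k : d → ℤ, Torus.freqNormSq k *
        (inner ℂ (mFourierCoeff (EuclideanSpace.complexify ∘ u) k) (mFourierCoeff (EuclideanSpace.complexify ∘ U) k)).re)) :=
  (Torus.summable_freqNormSq_mul_re_inner hu hU).hasSum.comp Torus.tendsto_freqBall_atTop

/-- **Uniform bound of the partial cross enstrophy sums**:
`4π² |∑_{|k|≤N} |k|² Re ⟪û, Û⟫| ≤ ½ (‖∇u‖₂² + ‖∇U‖₂²)`. [folklore] -/
theorem Torus.abs_sum_freqNormSq_mul_re_inner_le {u U : UnitAddTorus d → EuclideanSpace ℝ d}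
    (hu : Torus.eGradNormSq u ≠ ⊤) (hU : Torus.eGradNormSq U ≠ ⊤) (N : ℕ) :
    4 * Real.pi ^ 2 * |∑ k ∈ Torus.freqBall N, Torus.freqNormSq k *
      (inner ℂ (mFourierCoeff (EuclideanSpace.complexify ∘ u) k) (mFourierCoeff (EuclideanSpace.complexify ∘ U) k)).re| ≤
      2⁻¹ * ((Torus.eGradNormSq u).toReal + (Torus.eGradNormSq U).toReal) := by
  have hsu := Torus.summable_freqNormSq_mul_norm_sq hu
  have hsU := Torus.summable_freqNormSq_mul_norm_sq hU
  have h1 : |∑ k ∈ Torus.freqBall N, Torus.freqNormSq k *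
      (inner ℂ (mFourierCoeff (EuclideanSpace.complexify ∘ u) k) (mFourierCoeff (EuclideanSpace.complexify ∘ U) k)).re| ≤
      ∑ k ∈ Torus.freqBall N, 2⁻¹ * (Torus.freqNormSq k * ‖mFourierCoeff (EuclideanSpace.complexify ∘ u) k‖ ^ 2 +
        Torus.freqNormSq k * ‖mFourierCoeff (EuclideanSpace.complexify ∘ U) k‖ ^ 2) :=
    (Finset.abs_sum_le_sum_abs _ _).trans (Finset.sum_le_sum fun k _ => Torus.abs_freqNormSq_mul_re_inner_le k _ _)
  have h2 : ∑ k ∈ Torus.freqBall N, 2⁻¹ * (Torus.freqNormSq k * ‖mFourierCoeff (EuclideanSpace.complexify ∘ u) k‖ ^ 2 +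
        Torus.freqNormSq k * ‖mFourierCoeff (EuclideanSpace.complexify ∘ U) k‖ ^ 2) ≤
      2⁻¹ * ((∑' k : d → ℤ, Torus.freqNormSq k * ‖mFourierCoeff (EuclideanSpace.complexify ∘ u) k‖ ^ 2) +
        ∑' k : d → ℤ, Torus.freqNormSq k * ‖mFourierCoeff (EuclideanSpace.complexify ∘ U) k‖ ^ 2) := by
    rw [← Finset.mul_sum, Finset.sum_add_distrib]
    refine mul_le_mul_of_nonneg_left (add_le_add ?_ ?_) (by norm_num)
    · exact hsu.sum_le_tsum _ (fun k _ => mul_nonneg (Torus.freqNormSq_nonneg k) (sq_nonneg _))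
    · exact hsU.sum_le_tsum _ (fun k _ => mul_nonneg (Torus.freqNormSq_nonneg k) (sq_nonneg _))
  rw [← Torus.tsum_freqNormSq_mul_norm_sq_eq u, ← Torus.tsum_freqNormSq_mul_norm_sq_eq U]
  nlinarith [h1, h2, Real.pi_pos, sq_nonneg Real.pi]

omit [DecidableEq d] in
/-- **The enstrophy of a difference in terms of the cross enstrophy**:
`‖∇(u - U)‖₂² = ‖∇u‖₂² + ‖∇U‖₂² - 2 · 4π² ∑' |k|² Re ⟪û, Û⟫` for finite-enstrophy `L¹` fields
(termwise `‖a - b‖² = ‖a‖² + ‖b‖² - 2 Re ⟪a, b⟫`). [folklore] -/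
theorem Torus.toReal_eGradNormSq_sub_eq {u U : UnitAddTorus d → EuclideanSpace ℝ d}
    (hui : Integrable u volume) (hUi : Integrable U volume)
    (hu : Torus.eGradNormSq u ≠ ⊤) (hU : Torus.eGradNormSq U ≠ ⊤) :
    (Torus.eGradNormSq (u - U)).toReal = (Torus.eGradNormSq u).toReal + (Torus.eGradNormSq U).toReal -
      2 * (4 * Real.pi ^ 2 * ∑' k : d → ℤ, Torus.freqNormSq k *
        (inner ℂ (mFourierCoeff (EuclideanSpace.complexify ∘ u) k) (mFourierCoeff (EuclideanSpace.complexify ∘ U) k)).re) := by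
  rw [← Torus.tsum_freqNormSq_mul_norm_sq_eq (u - U), ← Torus.tsum_freqNormSq_mul_norm_sq_eq u,
    ← Torus.tsum_freqNormSq_mul_norm_sq_eq U]
  have hsu := Torus.summable_freqNormSq_mul_norm_sq hu
  have hsU := Torus.summable_freqNormSq_mul_norm_sq hU
  have hsc := Torus.summable_freqNormSq_mul_re_inner hu hU
  have hterm : ∀ k : d → ℤ, Torus.freqNormSq k * ‖mFourierCoeff (EuclideanSpace.complexify ∘ (u - U)) k‖ ^ 2 =
      Torus.freqNormSq k * ‖mFourierCoeff (EuclideanSpace.complexify ∘ u) k‖ ^ 2 +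
        Torus.freqNormSq k * ‖mFourierCoeff (EuclideanSpace.complexify ∘ U) k‖ ^ 2 -
        2 * (Torus.freqNormSq k * (inner ℂ (mFourierCoeff (EuclideanSpace.complexify ∘ u) k)
          (mFourierCoeff (EuclideanSpace.complexify ∘ U) k)).re) := by
    intro k
    rw [Torus.mFourierCoeff_complexify_sub hui hUi k, @norm_sub_sq ℂ]
    simp only [RCLike.re_to_complex]
    ring
  simp_rw [hterm]
  rw [(hsu.add hsU).tsum_sub (hsc.mul_left 2), hsu.tsum_add hsU, tsum_mul_left]
  ring

omit [DecidableEq d] in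
/-- The truncation tail is at most the `L²` mass: `∫⁻ ‖P_N v - v‖ₑ² ≤ ∫⁻ ‖v‖ₑ²`. [folklore] -/
theorem Torus.lintegral_enorm_sq_fourierTruncate_sub_le_self [DecidableEq d] {v : UnitAddTorus d → EuclideanSpace ℝ d}
    (hv : MemLp v 2 volume) (N : ℕ) :
    ∫⁻ x, ‖Torus.fourierTruncate N v x - v x‖ₑ ^ 2 ≤ ∫⁻ x, ‖v x‖ₑ ^ 2 := by
  rw [Torus.lintegral_enorm_sq_fourierTruncate_sub hv, ← Torus.tsum_enorm_sq_mFourierCoeff_complexify hv]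
  exact ENNReal.tsum_comp_le_tsum_of_injective Subtype.val_injective _

/-! ### The anisotropic estimates on the truncations (three dimensions) -/

section ThreeD

/-- For a trigonometric polynomial the classical `H¹` quantity is the spectral one:
`∫⁻‖P‖² + ∑ᵢ ∫⁻‖∂ᵢP‖² = ∫⁻‖P‖² + eGradNormSq P`. [folklore] -/
theorem Torus.lintegral_add_sum_partialDeriv_eq_of_isSmooth {P : UnitAddTorus (Fin 3) → EuclideanSpace ℝ (Fin 3)} (hP : Torus.IsSmooth P) :
    (∫⁻ x, ‖P x‖ₑ ^ 2) + ∑ i, ∫⁻ x, ‖Torus.partialDeriv i P x‖ₑ ^ 2 =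
      (∫⁻ x, ‖P x‖ₑ ^ 2) + Torus.eGradNormSq P := by
  rw [Torus.sum_lintegral_enorm_sq_partialDeriv_eq_eGradNormSq hP]

/-- **The trilinear term on the truncations is controlled by the anisotropic kernel.** For
`v, V ∈ L²(T³; ℝ³)` with `V` independent of `x₃`, `w̃ = P_N v - P_N V`, `Ṽ = P_N V`:
`|∫ ⟪w̃, (w̃·∇)Ṽ⟫| ≤ 9C ‖w‖₂^{1/2} (‖w‖₂² + ‖∇w‖₂²)^{1/4} · ‖w‖₂^{1/2} (‖w‖₂² + ‖∇w‖₂²)^{1/4} · ‖∇V‖₂`,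
`w = v - V` (`Torus.enorm_integral_inner_convect_le_anisotropic` on the truncations, whose `L²`
masses and enstrophies are dominated by those of `w` and `V`; Bardos et al. 2013, proof of
Thm. 3.1, the bound of `((w·∇)…, u)`). [cite: BardosEtAl2013, Thm. 3.1 (proof)] -/
theorem Torus.enorm_integral_inner_convect_truncate_sub_le {v V : UnitAddTorus (Fin 3) → EuclideanSpace ℝ (Fin 3)} (hv : MemLp v 2 volume)
    (hV : MemLp V 2 volume)
    (hVinv : ∀ (s : UnitAddCircle) (x : UnitAddTorus (Fin 3)), V (x + Pi.single (2 : Fin 3) s) = V x) (N : ℕ) :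
    ‖∫ x, ⟪Torus.fourierTruncate N v x - Torus.fourierTruncate N V x,
        Torus.convect (fun y => Torus.fourierTruncate N v y - Torus.fourierTruncate N V y)
          (Torus.fourierTruncate N V) x⟫_ℝ‖ₑ ≤
      9 * Torus.anisotropicConst *
        ((∫⁻ x, ‖v x - V x‖ₑ ^ 2) ^ (1 / 4 : ℝ) * ((∫⁻ x, ‖v x - V x‖ₑ ^ 2) + Torus.eGradNormSq (v - V)) ^ (1 / 4 : ℝ)) *
        ((∫⁻ x, ‖v x - V x‖ₑ ^ 2) ^ (1 / 4 : ℝ) * ((∫⁻ x, ‖v x - V x‖ₑ ^ 2) + Torus.eGradNormSq (v - V)) ^ (1 / 4 : ℝ)) *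
        Torus.eGradNormSq V ^ (1 / 2 : ℝ) := by
  have hvi : Integrable v volume := hv.integrable one_le_two
  have hVi : Integrable V volume := hV.integrable one_le_two
  have hw : MemLp (v - V) 2 volume := hv.sub hV
  set W : UnitAddTorus (Fin 3) → EuclideanSpace ℝ (Fin 3) := fun y => Torus.fourierTruncate N v y - Torus.fourierTruncate N V y with hWdef
  have hWeq : W = Torus.fourierTruncate N (v - V) := (Torus.fourierTruncate_sub hvi hVi N).symm
  have hWs : Torus.IsSmooth W := by rw [hWeq]; exact Torus.isSmooth_fourierTruncate _ _
  have hVNs : Torus.IsSmooth (Torus.fourierTruncate N V) := Torus.isSmooth_fourierTruncate _ _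
  have hVNinv : ∀ (s : UnitAddCircle) (x : UnitAddTorus (Fin 3)),
      Torus.fourierTruncate N V (x + Pi.single (2 : Fin 3) s) = Torus.fourierTruncate N V x :=
    Torus.fourierTruncate_add_single hVinv N
  have h := Torus.enorm_integral_inner_convect_le_anisotropic hWs hWs hVNs hVNinv
  refine h.trans ?_
  -- the factors
  have hA : ∫⁻ x, ‖W x‖ₑ ^ 2 ≤ ∫⁻ x, ‖v x - V x‖ₑ ^ 2 := by
    rw [hWeq]; exact Torus.lintegral_enorm_sq_fourierTruncate_le hw N
  have hB : (∫⁻ x, ‖W x‖ₑ ^ 2) + ∑ i, ∫⁻ x, ‖Torus.partialDeriv i W x‖ₑ ^ 2 ≤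
      (∫⁻ x, ‖v x - V x‖ₑ ^ 2) + Torus.eGradNormSq (v - V) := by
    rw [Torus.lintegral_add_sum_partialDeriv_eq_of_isSmooth hWs]
    refine add_le_add hA ?_
    rw [hWeq]; exact eGradNormSq_fourierTruncate_le (hw.integrable one_le_two) N
  have hG : ∑ i, ∫⁻ x, ‖Torus.partialDeriv i (Torus.fourierTruncate N V) x‖ₑ ^ 2 ≤ Torus.eGradNormSq V := by
    rw [Torus.sum_lintegral_enorm_sq_partialDeriv_eq_eGradNormSq hVNs]
    exact eGradNormSq_fourierTruncate_le hVi N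
  refine mul_le_mul' (mul_le_mul' (mul_le_mul' le_rfl (mul_le_mul' ?_ ?_)) (mul_le_mul' ?_ ?_)) ?_
  · exact ENNReal.rpow_le_rpow hA (by norm_num)
  · exact ENNReal.rpow_le_rpow hB (by norm_num)
  · exact ENNReal.rpow_le_rpow hA (by norm_num)
  · exact ENNReal.rpow_le_rpow hB (by norm_num)
  · exact ENNReal.rpow_le_rpow hG (by norm_num)

/-- Splitting of the convective pairing of two transporting fields against one test field:
`∫ ⟪p,(p·∇)Ψ⟫ - ∫ ⟪q,(q·∇)Ψ⟫ = ∫ ⟪p - q, (p·∇)Ψ⟫ + ∫ ⟪q, ((p - q)·∇)Ψ⟫` (smooth fields). [folklore] -/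
theorem Torus.integral_inner_convect_sub_integral_inner_convect {p q Ψ : UnitAddTorus (Fin 3) → EuclideanSpace ℝ (Fin 3)} (hp : Torus.IsSmooth p)
    (hq : Torus.IsSmooth q) (hΨ : Torus.IsSmooth Ψ) :
    (∫ x, ⟪p x, Torus.convect p Ψ x⟫_ℝ) - ∫ x, ⟪q x, Torus.convect q Ψ x⟫_ℝ =
      (∫ x, ⟪p x - q x, Torus.convect p Ψ x⟫_ℝ) + ∫ x, ⟪q x, Torus.convect (fun y => p y - q y) Ψ x⟫_ℝ := by
  have hcont : ∀ {a b : UnitAddTorus (Fin 3) → EuclideanSpace ℝ (Fin 3)}, Continuous a → Continuous b →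
      Continuous fun x => ⟪a x, Torus.fderiv Ψ x (b x)⟫_ℝ := by
    intro a b ha hb
    have h : (fun x => Torus.fderiv Ψ x (b x)) = fun x => ∑ i, (b x) i • Torus.partialDeriv i Ψ x := by
      funext x; exact Torus.fderiv_apply_eq_sum_partialDeriv (hΨ.isContDiff (by simp)) _ _
    refine ha.inner ?_
    rw [h]
    exact continuous_finsetSum _ fun i _ =>
      (((EuclideanSpace.proj (𝕜 := ℝ) i).continuous.comp hb).smul (hΨ.partialDeriv i).continuous)
  have hpc := hp.continuous
  have hqc := hq.continuous
  have i1 : Integrable (fun x => ⟪p x, Torus.fderiv Ψ x (p x)⟫_ℝ) volume := (hcont hpc hpc).integrable_unitAddTorus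
  have i2 : Integrable (fun x => ⟪q x, Torus.fderiv Ψ x (q x)⟫_ℝ) volume := (hcont hqc hqc).integrable_unitAddTorus
  have i3 : Integrable (fun x => ⟪p x - q x, Torus.fderiv Ψ x (p x)⟫_ℝ) volume :=
    (hcont (hpc.sub hqc) hpc).integrable_unitAddTorus
  have i4 : Integrable (fun x => ⟪q x, Torus.fderiv Ψ x (p x - q x)⟫_ℝ) volume :=
    (hcont hqc (hpc.sub hqc)).integrable_unitAddTorus
  simp only [Torus.convect]
  rw [← integral_sub i1 i2, ← integral_add i3 i4]
  refine integral_congr_ae (ae_of_all _ fun x => ?_)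
  simp only [map_sub, inner_sub_left, inner_sub_right]
  ring

/-- **Removing the truncation from the transporting field, invariant test field.** For
`v ∈ L²(T³; ℝ³)`, a smooth test field `Ψ` independent of `x₃`, and `ṽ = P_N v`:
`|∫ ⟪v,(v·∇)Ψ⟫ - ∫ ⟪ṽ,(ṽ·∇)Ψ⟫| ≤ 18C ‖v‖₂^{1/2} (‖v‖₂² + ‖∇v‖₂²)^{1/2} ‖P_N v - v‖₂^{1/2} ‖∇Ψ‖₂`
(write the difference at level `M ≥ N` as two trilinear terms,
`Torus.integral_inner_convect_sub_integral_inner_convect`, bound them by the anisotropic estimate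
`Torus.enorm_integral_inner_convect_le_anisotropic`, uniformly in `M` through Bessel and the
nested-truncation bounds, and let `M → ∞`, `Torus.tendsto_integral_inner_convect_fourierTruncate`). [cite: BardosEtAl2013, Thm. 3.1 (proof)] -/
theorem Torus.enorm_integral_inner_convect_sub_truncate_le {v Ψ : UnitAddTorus (Fin 3) → EuclideanSpace ℝ (Fin 3)} (hv : MemLp v 2 volume)
    (hΨ : Torus.IsSmooth Ψ) (hΨinv : ∀ (s : UnitAddCircle) (x : UnitAddTorus (Fin 3)), Ψ (x + Pi.single (2 : Fin 3) s) = Ψ x)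
    (N : ℕ) :
    ‖(∫ x, ⟪v x, Torus.convect v Ψ x⟫_ℝ) -
        ∫ x, ⟪Torus.fourierTruncate N v x, Torus.convect (Torus.fourierTruncate N v) Ψ x⟫_ℝ‖ₑ ≤
      18 * Torus.anisotropicConst * (∫⁻ x, ‖v x‖ₑ ^ 2) ^ (1 / 4 : ℝ) *
        ((∫⁻ x, ‖v x‖ₑ ^ 2) + Torus.eGradNormSq v) ^ (1 / 2 : ℝ) *
        (∫⁻ x, ‖Torus.fourierTruncate N v x - v x‖ₑ ^ 2) ^ (1 / 4 : ℝ) *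
        (∑ i, ∫⁻ x, ‖Torus.partialDeriv i Ψ x‖ₑ ^ 2) ^ (1 / 2 : ℝ) := by
  have hvi : Integrable v volume := hv.integrable one_le_two
  set Av : ℝ≥0∞ := ∫⁻ x, ‖v x‖ₑ ^ 2 with hAv
  set Bv : ℝ≥0∞ := (∫⁻ x, ‖v x‖ₑ ^ 2) + Torus.eGradNormSq v with hBv
  set δ : ℝ≥0∞ := ∫⁻ x, ‖Torus.fourierTruncate N v x - v x‖ₑ ^ 2 with hδ
  set G : ℝ≥0∞ := ∑ i, ∫⁻ x, ‖Torus.partialDeriv i Ψ x‖ₑ ^ 2 with hG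
  set C : ℝ≥0∞ := Torus.anisotropicConst with hC
  -- ### the bound at level `M ≥ N`
  have hM : ∀ M, N ≤ M →
      ‖(∫ x, ⟪Torus.fourierTruncate M v x, Torus.convect (Torus.fourierTruncate M v) Ψ x⟫_ℝ) -
        ∫ x, ⟪Torus.fourierTruncate N v x, Torus.convect (Torus.fourierTruncate N v) Ψ x⟫_ℝ‖ₑ ≤
      18 * C * Av ^ (1 / 4 : ℝ) * Bv ^ (1 / 2 : ℝ) * δ ^ (1 / 4 : ℝ) * G ^ (1 / 2 : ℝ) := by
    intro M hNM
    set p := Torus.fourierTruncate M v with hp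
    set q := Torus.fourierTruncate N v with hq
    have hps : Torus.IsSmooth p := Torus.isSmooth_fourierTruncate _ _
    have hqs : Torus.IsSmooth q := Torus.isSmooth_fourierTruncate _ _
    have hpqs : Torus.IsSmooth (fun y => p y - q y) := hps.sub hqs
    rw [Torus.integral_inner_convect_sub_integral_inner_convect hps hqs hΨ]
    -- the two trilinear terms
    have T1 := Torus.enorm_integral_inner_convect_le_anisotropic (a := p) (b := fun y => p y - q y) hps hpqs hΨ hΨinv
    have T2 := Torus.enorm_integral_inner_convect_le_anisotropic (a := fun y => p y - q y) (b := q) hpqs hqs hΨ hΨinv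
    -- spectral bounds of the factors
    have hAp : ∫⁻ x, ‖p x‖ₑ ^ 2 ≤ Av := Torus.lintegral_enorm_sq_fourierTruncate_le hv M
    have hAq : ∫⁻ x, ‖q x‖ₑ ^ 2 ≤ Av := Torus.lintegral_enorm_sq_fourierTruncate_le hv N
    have hApq : ∫⁻ x, ‖p x - q x‖ₑ ^ 2 ≤ δ := Torus.lintegral_enorm_sq_fourierTruncate_sub_fourierTruncate_le hv hNM
    have hδA : δ ≤ Av := Torus.lintegral_enorm_sq_fourierTruncate_sub_le_self hv N
    have hBp : (∫⁻ x, ‖p x‖ₑ ^ 2) + ∑ i, ∫⁻ x, ‖Torus.partialDeriv i p x‖ₑ ^ 2 ≤ Bv := by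
      rw [Torus.lintegral_add_sum_partialDeriv_eq_of_isSmooth hps]
      exact add_le_add hAp (eGradNormSq_fourierTruncate_le hvi M)
    have hBq : (∫⁻ x, ‖q x‖ₑ ^ 2) + ∑ i, ∫⁻ x, ‖Torus.partialDeriv i q x‖ₑ ^ 2 ≤ Bv := by
      rw [Torus.lintegral_add_sum_partialDeriv_eq_of_isSmooth hqs]
      exact add_le_add hAq (eGradNormSq_fourierTruncate_le hvi N)
    have hBpq : (∫⁻ x, ‖p x - q x‖ₑ ^ 2) + ∑ i, ∫⁻ x, ‖Torus.partialDeriv i (fun y => p y - q y) x‖ₑ ^ 2 ≤ Bv := by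
      rw [Torus.lintegral_add_sum_partialDeriv_eq_of_isSmooth hpqs]
      refine add_le_add (hApq.trans hδA) ?_
      have : (fun y => p y - q y) = Torus.fourierTruncate M v - Torus.fourierTruncate N v := rfl
      rw [this]
      exact Torus.eGradNormSq_fourierTruncate_sub_fourierTruncate_le hvi hNM
    have e1 : ‖∫ x, ⟪p x - q x, Torus.convect p Ψ x⟫_ℝ‖ₑ ≤
        9 * C * (Av ^ (1 / 4 : ℝ) * Bv ^ (1 / 4 : ℝ)) * (δ ^ (1 / 4 : ℝ) * Bv ^ (1 / 4 : ℝ)) * G ^ (1 / 2 : ℝ) := by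
      refine T1.trans ?_
      refine mul_le_mul' (mul_le_mul' (mul_le_mul' le_rfl (mul_le_mul' ?_ ?_)) (mul_le_mul' ?_ ?_)) le_rfl
      · exact ENNReal.rpow_le_rpow hAp (by norm_num)
      · exact ENNReal.rpow_le_rpow hBp (by norm_num)
      · exact ENNReal.rpow_le_rpow hApq (by norm_num)
      · exact ENNReal.rpow_le_rpow hBpq (by norm_num)
    have e2 : ‖∫ x, ⟪q x, Torus.convect (fun y => p y - q y) Ψ x⟫_ℝ‖ₑ ≤
        9 * C * (δ ^ (1 / 4 : ℝ) * Bv ^ (1 / 4 : ℝ)) * (Av ^ (1 / 4 : ℝ) * Bv ^ (1 / 4 : ℝ)) * G ^ (1 / 2 : ℝ) := by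
      refine T2.trans ?_
      refine mul_le_mul' (mul_le_mul' (mul_le_mul' le_rfl (mul_le_mul' ?_ ?_)) (mul_le_mul' ?_ ?_)) le_rfl
      · exact ENNReal.rpow_le_rpow hApq (by norm_num)
      · exact ENNReal.rpow_le_rpow hBpq (by norm_num)
      · exact ENNReal.rpow_le_rpow hAq (by norm_num)
      · exact ENNReal.rpow_le_rpow hBq (by norm_num)
    have hBB : Bv ^ (1 / 4 : ℝ) * Bv ^ (1 / 4 : ℝ) = Bv ^ (1 / 2 : ℝ) := by
      rw [← ENNReal.rpow_add_of_nonneg _ _ (by norm_num) (by norm_num)]; norm_num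
    calc _ ≤ ‖∫ x, ⟪p x - q x, Torus.convect p Ψ x⟫_ℝ‖ₑ + ‖∫ x, ⟪q x, Torus.convect (fun y => p y - q y) Ψ x⟫_ℝ‖ₑ :=
          enorm_add_le _ _
      _ ≤ 9 * C * (Av ^ (1 / 4 : ℝ) * Bv ^ (1 / 4 : ℝ)) * (δ ^ (1 / 4 : ℝ) * Bv ^ (1 / 4 : ℝ)) * G ^ (1 / 2 : ℝ) +
          9 * C * (δ ^ (1 / 4 : ℝ) * Bv ^ (1 / 4 : ℝ)) * (Av ^ (1 / 4 : ℝ) * Bv ^ (1 / 4 : ℝ)) * G ^ (1 / 2 : ℝ) :=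
          add_le_add e1 e2
      _ = 18 * C * Av ^ (1 / 4 : ℝ) * (Bv ^ (1 / 4 : ℝ) * Bv ^ (1 / 4 : ℝ)) * δ ^ (1 / 4 : ℝ) * G ^ (1 / 2 : ℝ) := by ring
      _ = _ := by rw [hBB]
  -- ### the limit `M → ∞`
  have hlim : Tendsto (fun M => ‖(∫ x, ⟪Torus.fourierTruncate M v x, Torus.convect (Torus.fourierTruncate M v) Ψ x⟫_ℝ) -
      ∫ x, ⟪Torus.fourierTruncate N v x, Torus.convect (Torus.fourierTruncate N v) Ψ x⟫_ℝ‖ₑ) atTop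
      (𝓝 ‖(∫ x, ⟪v x, Torus.convect v Ψ x⟫_ℝ) -
        ∫ x, ⟪Torus.fourierTruncate N v x, Torus.convect (Torus.fourierTruncate N v) Ψ x⟫_ℝ‖ₑ) :=
    (continuous_enorm.tendsto _).comp ((Torus.tendsto_integral_inner_convect_fourierTruncate hv hΨ).sub tendsto_const_nhds)
  exact le_of_tendsto hlim (eventually_atTop.2 ⟨N, hM⟩)

/-- **Removing the truncation from the transporting field, invariant transporting field.** For
`V ∈ L²(T³; ℝ³)` independent of `x₃`, any smooth test field `Ψ`, and `Ṽ = P_N V`: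
`|∫ ⟪V,(V·∇)Ψ⟫ - ∫ ⟪Ṽ,(Ṽ·∇)Ψ⟫| ≤ 18C ‖V‖₂^{1/2} (‖V‖₂² + ‖∇V‖₂²)^{1/2} ‖P_N V - V‖₂^{1/2} ‖∇Ψ‖₂`
(as `Torus.enorm_integral_inner_convect_sub_truncate_le`, with the dual anisotropic estimate
`Torus.enorm_integral_inner_convect_le_anisotropic'`, the truncations of `V` being invariant). [cite: BardosEtAl2013, Thm. 3.1 (proof)] -/
theorem Torus.enorm_integral_inner_convect_sub_truncate_le' {V Ψ : UnitAddTorus (Fin 3) → EuclideanSpace ℝ (Fin 3)} (hV : MemLp V 2 volume)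
    (hVinv : ∀ (s : UnitAddCircle) (x : UnitAddTorus (Fin 3)), V (x + Pi.single (2 : Fin 3) s) = V x)
    (hΨ : Torus.IsSmooth Ψ) (N : ℕ) :
    ‖(∫ x, ⟪V x, Torus.convect V Ψ x⟫_ℝ) -
        ∫ x, ⟪Torus.fourierTruncate N V x, Torus.convect (Torus.fourierTruncate N V) Ψ x⟫_ℝ‖ₑ ≤
      18 * Torus.anisotropicConst * (∫⁻ x, ‖V x‖ₑ ^ 2) ^ (1 / 4 : ℝ) *
        ((∫⁻ x, ‖V x‖ₑ ^ 2) + Torus.eGradNormSq V) ^ (1 / 2 : ℝ) *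
        (∫⁻ x, ‖Torus.fourierTruncate N V x - V x‖ₑ ^ 2) ^ (1 / 4 : ℝ) *
        (∑ i, ∫⁻ x, ‖Torus.partialDeriv i Ψ x‖ₑ ^ 2) ^ (1 / 2 : ℝ) := by
  have hVi : Integrable V volume := hV.integrable one_le_two
  set Av : ℝ≥0∞ := ∫⁻ x, ‖V x‖ₑ ^ 2 with hAv
  set Bv : ℝ≥0∞ := (∫⁻ x, ‖V x‖ₑ ^ 2) + Torus.eGradNormSq V with hBv
  set δ : ℝ≥0∞ := ∫⁻ x, ‖Torus.fourierTruncate N V x - V x‖ₑ ^ 2 with hδ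
  set G : ℝ≥0∞ := ∑ i, ∫⁻ x, ‖Torus.partialDeriv i Ψ x‖ₑ ^ 2 with hG
  set C : ℝ≥0∞ := Torus.anisotropicConst with hC
  have hinvM : ∀ M (s : UnitAddCircle) (x : UnitAddTorus (Fin 3)),
      Torus.fourierTruncate M V (x + Pi.single (2 : Fin 3) s) = Torus.fourierTruncate M V x := fun M =>
    Torus.fourierTruncate_add_single hVinv M
  -- ### the bound at level `M ≥ N`
  have hM : ∀ M, N ≤ M →
      ‖(∫ x, ⟪Torus.fourierTruncate M V x, Torus.convect (Torus.fourierTruncate M V) Ψ x⟫_ℝ) -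
        ∫ x, ⟪Torus.fourierTruncate N V x, Torus.convect (Torus.fourierTruncate N V) Ψ x⟫_ℝ‖ₑ ≤
      18 * C * Av ^ (1 / 4 : ℝ) * Bv ^ (1 / 2 : ℝ) * δ ^ (1 / 4 : ℝ) * G ^ (1 / 2 : ℝ) := by
    intro M hNM
    set p := Torus.fourierTruncate M V with hp
    set q := Torus.fourierTruncate N V with hq
    have hps : Torus.IsSmooth p := Torus.isSmooth_fourierTruncate _ _
    have hqs : Torus.IsSmooth q := Torus.isSmooth_fourierTruncate _ _
    have hpqs : Torus.IsSmooth (fun y => p y - q y) := hps.sub hqs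
    have hpinv : ∀ (s : UnitAddCircle) (x : UnitAddTorus (Fin 3)), p (x + Pi.single (2 : Fin 3) s) = p x := hinvM M
    have hqinv : ∀ (s : UnitAddCircle) (x : UnitAddTorus (Fin 3)), q (x + Pi.single (2 : Fin 3) s) = q x := hinvM N
    have hpqinv : ∀ (s : UnitAddCircle) (x : UnitAddTorus (Fin 3)), p (x + Pi.single (2 : Fin 3) s) - q (x + Pi.single (2 : Fin 3) s) =
        p x - q x := fun s x => by rw [hpinv, hqinv]
    rw [Torus.integral_inner_convect_sub_integral_inner_convect hps hqs hΨ]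
    have T1 := Torus.enorm_integral_inner_convect_le_anisotropic' (a := p) (b := fun y => p y - q y) hps hpqs hΨ hpinv hpqinv
    have T2 := Torus.enorm_integral_inner_convect_le_anisotropic' (a := fun y => p y - q y) (b := q) hpqs hqs hΨ hpqinv hqinv
    have hAp : ∫⁻ x, ‖p x‖ₑ ^ 2 ≤ Av := Torus.lintegral_enorm_sq_fourierTruncate_le hV M
    have hAq : ∫⁻ x, ‖q x‖ₑ ^ 2 ≤ Av := Torus.lintegral_enorm_sq_fourierTruncate_le hV N
    have hApq : ∫⁻ x, ‖p x - q x‖ₑ ^ 2 ≤ δ := Torus.lintegral_enorm_sq_fourierTruncate_sub_fourierTruncate_le hV hNM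
    have hδA : δ ≤ Av := Torus.lintegral_enorm_sq_fourierTruncate_sub_le_self hV N
    have hBp : (∫⁻ x, ‖p x‖ₑ ^ 2) + ∑ i, ∫⁻ x, ‖Torus.partialDeriv i p x‖ₑ ^ 2 ≤ Bv := by
      rw [Torus.lintegral_add_sum_partialDeriv_eq_of_isSmooth hps]
      exact add_le_add hAp (eGradNormSq_fourierTruncate_le hVi M)
    have hBq : (∫⁻ x, ‖q x‖ₑ ^ 2) + ∑ i, ∫⁻ x, ‖Torus.partialDeriv i q x‖ₑ ^ 2 ≤ Bv := by
      rw [Torus.lintegral_add_sum_partialDeriv_eq_of_isSmooth hqs]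
      exact add_le_add hAq (eGradNormSq_fourierTruncate_le hVi N)
    have hBpq : (∫⁻ x, ‖p x - q x‖ₑ ^ 2) + ∑ i, ∫⁻ x, ‖Torus.partialDeriv i (fun y => p y - q y) x‖ₑ ^ 2 ≤ Bv := by
      rw [Torus.lintegral_add_sum_partialDeriv_eq_of_isSmooth hpqs]
      refine add_le_add (hApq.trans hδA) ?_
      have : (fun y => p y - q y) = Torus.fourierTruncate M V - Torus.fourierTruncate N V := rfl
      rw [this]
      exact Torus.eGradNormSq_fourierTruncate_sub_fourierTruncate_le hVi hNM
    have e1 : ‖∫ x, ⟪p x - q x, Torus.convect p Ψ x⟫_ℝ‖ₑ ≤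
        9 * C * (Av ^ (1 / 4 : ℝ) * Bv ^ (1 / 4 : ℝ)) * (δ ^ (1 / 4 : ℝ) * Bv ^ (1 / 4 : ℝ)) * G ^ (1 / 2 : ℝ) := by
      refine T1.trans ?_
      refine mul_le_mul' (mul_le_mul' (mul_le_mul' le_rfl (mul_le_mul' ?_ ?_)) (mul_le_mul' ?_ ?_)) le_rfl
      · exact ENNReal.rpow_le_rpow hAp (by norm_num)
      · exact ENNReal.rpow_le_rpow hBp (by norm_num)
      · exact ENNReal.rpow_le_rpow hApq (by norm_num)
      · exact ENNReal.rpow_le_rpow hBpq (by norm_num)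
    have e2 : ‖∫ x, ⟪q x, Torus.convect (fun y => p y - q y) Ψ x⟫_ℝ‖ₑ ≤
        9 * C * (δ ^ (1 / 4 : ℝ) * Bv ^ (1 / 4 : ℝ)) * (Av ^ (1 / 4 : ℝ) * Bv ^ (1 / 4 : ℝ)) * G ^ (1 / 2 : ℝ) := by
      refine T2.trans ?_
      refine mul_le_mul' (mul_le_mul' (mul_le_mul' le_rfl (mul_le_mul' ?_ ?_)) (mul_le_mul' ?_ ?_)) le_rfl
      · exact ENNReal.rpow_le_rpow hApq (by norm_num)
      · exact ENNReal.rpow_le_rpow hBpq (by norm_num)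
      · exact ENNReal.rpow_le_rpow hAq (by norm_num)
      · exact ENNReal.rpow_le_rpow hBq (by norm_num)
    have hBB : Bv ^ (1 / 4 : ℝ) * Bv ^ (1 / 4 : ℝ) = Bv ^ (1 / 2 : ℝ) := by
      rw [← ENNReal.rpow_add_of_nonneg _ _ (by norm_num) (by norm_num)]; norm_num
    calc _ ≤ ‖∫ x, ⟪p x - q x, Torus.convect p Ψ x⟫_ℝ‖ₑ + ‖∫ x, ⟪q x, Torus.convect (fun y => p y - q y) Ψ x⟫_ℝ‖ₑ :=
          enorm_add_le _ _
      _ ≤ 9 * C * (Av ^ (1 / 4 : ℝ) * Bv ^ (1 / 4 : ℝ)) * (δ ^ (1 / 4 : ℝ) * Bv ^ (1 / 4 : ℝ)) * G ^ (1 / 2 : ℝ) +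
          9 * C * (δ ^ (1 / 4 : ℝ) * Bv ^ (1 / 4 : ℝ)) * (Av ^ (1 / 4 : ℝ) * Bv ^ (1 / 4 : ℝ)) * G ^ (1 / 2 : ℝ) :=
          add_le_add e1 e2
      _ = 18 * C * Av ^ (1 / 4 : ℝ) * (Bv ^ (1 / 4 : ℝ) * Bv ^ (1 / 4 : ℝ)) * δ ^ (1 / 4 : ℝ) * G ^ (1 / 2 : ℝ) := by ring
      _ = _ := by rw [hBB]
  have hlim : Tendsto (fun M => ‖(∫ x, ⟪Torus.fourierTruncate M V x, Torus.convect (Torus.fourierTruncate M V) Ψ x⟫_ℝ) -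
      ∫ x, ⟪Torus.fourierTruncate N V x, Torus.convect (Torus.fourierTruncate N V) Ψ x⟫_ℝ‖ₑ) atTop
      (𝓝 ‖(∫ x, ⟪V x, Torus.convect V Ψ x⟫_ℝ) -
        ∫ x, ⟪Torus.fourierTruncate N V x, Torus.convect (Torus.fourierTruncate N V) Ψ x⟫_ℝ‖ₑ) :=
    (continuous_enorm.tendsto _).comp ((Torus.tendsto_integral_inner_convect_fourierTruncate hV hΨ).sub tendsto_const_nhds)
  exact le_of_tendsto hlim (eventually_atTop.2 ⟨N, hM⟩)

end ThreeD

/-! ### Time measurability of truncations and convective pairings along measurable families -/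

section Measurability

variable {μ : Measure ℝ} {u : ℝ → UnitAddTorus d → EuclideanSpace ℝ d}

omit [DecidableEq d] in
/-- **Slice Fourier coefficients of a jointly measurable family are measurable in time**
(`û(t)(k) = ∫ e_{-k} • complexify (u t)`, Fubini measurability). [folklore] -/
theorem Torus.aestronglyMeasurable_mFourierCoeff_complexify_slice
    (hu : AEStronglyMeasurable (uncurry u) (μ.prod volume)) (k : d → ℤ) :
    AEStronglyMeasurable (fun t => mFourierCoeff (EuclideanSpace.complexify ∘ u t) k) μ := by
  have hF : AEStronglyMeasurable (fun z : ℝ × UnitAddTorus d => mFourier (-k) z.2 • EuclideanSpace.complexify (u z.1 z.2))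
      (μ.prod volume) :=
    ((mFourier (-k)).continuous.aestronglyMeasurable.comp_snd).smul
      (EuclideanSpace.complexify.continuous.comp_aestronglyMeasurable hu)
  have h := hF.integral_prod_right'
  refine h.congr (ae_of_all _ fun t => ?_)
  exact (Torus.mFourierCoeff_eq_integral_volume _ k).symm

omit [DecidableEq d] in
/-- **Real trigonometric polynomials with time-measurable coefficients are jointly measurable.** [folklore] -/
theorem Torus.aestronglyMeasurable_uncurry_realTrigPoly (S : Finset (d → ℤ))
    {c : ℝ → (d → ℤ) → EuclideanSpace ℂ d} (hc : ∀ k ∈ S, AEStronglyMeasurable (fun t => c t k) μ) :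
    AEStronglyMeasurable (uncurry fun t x => Torus.realTrigPoly S (c t) x) (μ.prod volume) := by
  have h : (uncurry fun t x => Torus.realTrigPoly S (c t) x) =
      fun z : ℝ × UnitAddTorus d => EuclideanSpace.realPart (∑ k ∈ S, mFourier k z.2 • c z.1 k) := by
    funext z; rfl
  rw [h]
  refine EuclideanSpace.realPart.continuous.comp_aestronglyMeasurable ?_
  exact Finset.aestronglyMeasurable_fun_sum S fun k hk =>
    ((mFourier k).continuous.aestronglyMeasurable.comp_snd).smul (hc k hk).comp_fst

/-- **Truncations of a jointly measurable family are jointly measurable.** [folklore] -/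
theorem Torus.aestronglyMeasurable_uncurry_fourierTruncate
    (hu : AEStronglyMeasurable (uncurry u) (μ.prod volume)) (N : ℕ) :
    AEStronglyMeasurable (uncurry fun t x => Torus.fourierTruncate N (u t) x) (μ.prod volume) :=
  Torus.aestronglyMeasurable_uncurry_realTrigPoly _ fun k _ =>
    Torus.aestronglyMeasurable_mFourierCoeff_complexify_slice hu k

/-- Partial derivatives of truncations of a jointly measurable family are jointly measurable. [folklore] -/
theorem Torus.aestronglyMeasurable_uncurry_partialDeriv_fourierTruncate
    (hu : AEStronglyMeasurable (uncurry u) (μ.prod volume)) (N : ℕ) (i : d) :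
    AEStronglyMeasurable (uncurry fun t x => Torus.partialDeriv i (Torus.fourierTruncate N (u t)) x) (μ.prod volume) := by
  have h : (uncurry fun t x => Torus.partialDeriv i (Torus.fourierTruncate N (u t)) x) =
      uncurry fun t x => Torus.realTrigPoly (Torus.freqBall N)
        (fun k => (2 * Real.pi * Complex.I * (k i)) • mFourierCoeff (EuclideanSpace.complexify ∘ u t) k) x := by
    funext z
    simp only [uncurry, Torus.fourierTruncate_eq, Torus.partialDeriv_realTrigPoly]
  rw [h]
  exact Torus.aestronglyMeasurable_uncurry_realTrigPoly _ fun k _ =>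
    (aestronglyMeasurable_const (b := (2 * Real.pi * Complex.I * (k i) : ℂ))).smul
      (Torus.aestronglyMeasurable_mFourierCoeff_complexify_slice hu k)

/-- **Joint measurability of convective integrands against truncations**: for jointly measurable
families `a, b` and `c`, `(t, x) ↦ ⟪b t x, ((a t·∇) P_N (c t))(x)⟫` is jointly measurable. [folklore] -/
theorem Torus.aestronglyMeasurable_uncurry_inner_convect_fourierTruncate
    {a b c : ℝ → UnitAddTorus d → EuclideanSpace ℝ d}
    (ha : AEStronglyMeasurable (uncurry a) (μ.prod volume)) (hb : AEStronglyMeasurable (uncurry b) (μ.prod volume))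
    (hc : AEStronglyMeasurable (uncurry c) (μ.prod volume)) (N : ℕ) :
    AEStronglyMeasurable (uncurry fun t x => ⟪b t x, Torus.convect (a t) (Torus.fourierTruncate N (c t)) x⟫_ℝ)
      (μ.prod volume) := by
  have h : (uncurry fun t x => ⟪b t x, Torus.convect (a t) (Torus.fourierTruncate N (c t)) x⟫_ℝ) =
      fun z : ℝ × UnitAddTorus d => ⟪uncurry b z, ∑ i, (uncurry a z) i •
        uncurry (fun t x => Torus.partialDeriv i (Torus.fourierTruncate N (c t)) x) z⟫_ℝ := by
    funext z
    simp only [uncurry]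
    rw [Torus.convect, Torus.fderiv_apply_eq_sum_partialDeriv
      ((Torus.isSmooth_fourierTruncate N (c z.1)).isContDiff (by simp))]
  rw [h]
  refine hb.inner (Finset.aestronglyMeasurable_fun_sum _ fun i _ => ?_)
  exact ((EuclideanSpace.proj (𝕜 := ℝ) i).continuous.comp_aestronglyMeasurable ha).smul
    (Torus.aestronglyMeasurable_uncurry_partialDeriv_fourierTruncate hc N i)

/-- **Time measurability of convective pairings against truncations**:
`t ↦ ∫ ⟪b t, ((a t·∇) P_N (c t))⟫` is a.e. strongly measurable (Fubini measurability). [folklore] -/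
theorem Torus.aestronglyMeasurable_integral_inner_convect_fourierTruncate
    {a b c : ℝ → UnitAddTorus d → EuclideanSpace ℝ d}
    (ha : AEStronglyMeasurable (uncurry a) (μ.prod volume)) (hb : AEStronglyMeasurable (uncurry b) (μ.prod volume))
    (hc : AEStronglyMeasurable (uncurry c) (μ.prod volume)) (N : ℕ) :
    AEStronglyMeasurable (fun t => ∫ x, ⟪b t x, Torus.convect (a t) (Torus.fourierTruncate N (c t)) x⟫_ℝ) μ :=
  (Torus.aestronglyMeasurable_uncurry_inner_convect_fourierTruncate ha hb hc N).integral_prod_right'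

end Measurability

end Literature.Analysis.FluidPDE

end
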